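import Literature.MathematicalPhysics.MHD.SolovevCheaseFamily
import Summits.Ventures.FusionMHD.Bench.SolovevPCFIterQedge
import HarnessLib

/-!
# F1 / QEDGE — the certified edge safety factor of the ITER-like PCF Solov'ev equilibrium IS the printed
# CHEASE/Lee–Cerfon closed form `(2q₀/π)(R₀³/(R_min² R_max)) E(k)` (exact kernel identity)
(venture LADDER-GRIDFUSION, rung F1.a; cell `gridfusion`, seat `gridfusion-lit-4`, 2026-08-26; bridge between
`Bench/SolovevPCFIterQedge.lean` (seat sos-6: kernel-checked rational ENCLOSURE of `qEdgeOverF = edgeI/(4π√K)`) and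
`Literature/MathematicalPhysics/MHD/SolovevCheaseFamily.lean` (seat model-5: the CHEASE/Lee–Cerfon Solov'ev family with
the printed exact safety factor (q4), whose elliptic evaluation `QLCClosedForm` is proved there by seat lit-4).)

WHAT IS PROVED (pure real analysis; no new definition, no certificate data):
* §1 `integral_outerBranch` / `integral_innerBranch` / `integral_desingularised_eq`: for `0 < a < b`, `ρ = (b² − a²)/2`, the
  two de-singularising substitutions of §0 of `SolovevPCFIterQedge` (`R = (b² − ρw²)^{1/2}` on the outer half,
  `R = (a² + ρw²)^{1/2}` on the inner half, `w ∈ [0, 1]`) are UNDONE by Mathlib's one-dimensional change-of-variables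
  theorems for monotone maps (`MeasureTheory.integral_Icc_deriv_smul_of_deriv_nonneg/nonpos`; integrability of the
  singular midplane integrand is TRANSPORTED from the continuous `w`-integrands by `integrableOn_Icc_deriv_smul_iff_*`):
  `∫₀¹ [((b²−ρw²)^{3/2}(2−w²)^{1/2})⁻¹ + ((a²+ρw²)^{3/2}(2−w²)^{1/2})⁻¹] dw = ∫_a^b dR/(R²((R²−a²)(b²−R²))^{1/2})
  = E((1 − a²/b²)^{1/2})/(a²b)` (last step = Lee–Cerfon (q4), `Solovev.integral_qLC_kernel`).
* §2 instance of record (ITER-like PCF shape `(ε, κ, δ) = (8/25, 17/10, 33/100)`; edge midplane radii `a = 1 − ε = 17/25`,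
  `b = 1 + ε = 33/25`; `ρ = 16/25`, `u₀ = R_a² = 689/625`, `k² = 1 − a²/b² = 800/1089`, all exact): `edgeI_eq_ellipticE`
  (`edgeI = 2E(k)/(a²b)`), **`qEdgeOverF_eq_ellipticE`** (`qEdgeOverF = E(k)/(2π√K a²b)`), **`qEdgeOverF_eq_qLC`**
  (`qEdgeOverF = qLC (q₀/F) R_a a b` = the printed (q4) with `q₀ ↦ q₀/F = √r`, `R₀ ↦ R_a = √(689/625)`, via the exact
  identity `16·r·K·u₀³ = 1` between model-5's `q0OverFSq`, sos-6's `Kconst` and `u₀`), and `ellipticE_bounds`: the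
  Bench's certified enclosure of `edgeI` is a kernel-checked enclosure of the complete elliptic integral `E(√(800/1089))`.

HONEST FRAMING (three columns). CERTIFIED: kernel identities/inequalities about the typed reals `edgeI`, `qEdgeOverF`
(sos-6) and the typed functionals `ellipticE`, `qLC`; this upgrades the cell's previously VALIDATED comparison
«certified enclosure vs. the printed closed-form q of the CHEASE Solov'ev family evaluated in floats / by the referee's
AGM lineage» to a CERTIFIED one: the enclosed number IS the printed closed form [cite: LeeCerfon2015, §4.1 eq. (q4)] on
the instance of record. MODELLED: as in `SolovevPCFIterQedge` (identification of `F·qEdgeOverF` with the MHD safety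
factor, Freidberg (6.35), of the edge surface of an ideal-MHD Solov'ev-profile analytic fixed-boundary equilibrium);
nothing here says any plasma or device is stable. VALIDATED: nothing. No `native_decide`.
-/

noncomputable section

open Real MeasureTheory Set intervalIntegral
open Literature.MathematicalPhysics.MHD.Solovev (ellipticE qLC integral_qLC_kernel)
open Literature.Analysis.ValidatedNumerics.ExpPoly (Poly)

namespace Summit.Ventures.FusionMHD.Bench.SolovevPCFIter

/-! ## §1 Undoing the de-singularising substitutions (generic midplane radii `0 < a < b`) -/


/-- **Outer half of the midplane flux integral, de-singularised.** For `0 < a < b`, with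
`ρ = (b² − a²)/2` and `R₀ = ((a² + b²)/2)^{1/2}`, the substitution `R = (b² − ρw²)^{1/2}`, `w ∈ [0, 1]`
(antitone, `R(0) = b`, `R(1) = R₀`) gives
`∫₀¹ dw / ((b² − ρw²)^{3/2} (2 − w²)^{1/2}) = ∫_{R₀}^{b} dR / (R² ((R² − a²)(b² − R²))^{1/2})`,
and the singular right-hand integrand is integrable on `[R₀, b]`. [folklore; the inverse of the `§0`
reduction of `SolovevPCFIterQedge`] -/
theorem integral_outerBranch {a b : ℝ} (ha : 0 < a) (hab : a < b) :
    (∫ w in (0 : ℝ)..1, ((b ^ 2 - (b ^ 2 - a ^ 2) / 2 * w ^ 2)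
        * Real.sqrt (b ^ 2 - (b ^ 2 - a ^ 2) / 2 * w ^ 2) * Real.sqrt (2 - w ^ 2))⁻¹)
      = ∫ R in Real.sqrt ((a ^ 2 + b ^ 2) / 2)..b,
          1 / (R ^ 2 * Real.sqrt ((R ^ 2 - a ^ 2) * (b ^ 2 - R ^ 2))) ∧
    IntegrableOn (fun R => 1 / (R ^ 2 * Real.sqrt ((R ^ 2 - a ^ 2) * (b ^ 2 - R ^ 2))))
      (Icc (Real.sqrt ((a ^ 2 + b ^ 2) / 2)) b) := by
  have hb : 0 < b := ha.trans hab
  have hab2 : a ^ 2 < b ^ 2 := by nlinarith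
  set ρ : ℝ := (b ^ 2 - a ^ 2) / 2 with hρ
  have hρ0 : 0 < ρ := by rw [hρ]; linarith
  set g : ℝ → ℝ := fun R => 1 / (R ^ 2 * Real.sqrt ((R ^ 2 - a ^ 2) * (b ^ 2 - R ^ 2))) with hg
  set P : ℝ → ℝ := fun w => ((b ^ 2 - ρ * w ^ 2) * Real.sqrt (b ^ 2 - ρ * w ^ 2)
      * Real.sqrt (2 - w ^ 2))⁻¹ with hP
  set f : ℝ → ℝ := fun w => Real.sqrt (b ^ 2 - ρ * w ^ 2) with hf
  set f' : ℝ → ℝ := fun w => -(ρ * w) / Real.sqrt (b ^ 2 - ρ * w ^ 2) with hf'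
  -- positivity facts on `[0, 1]`
  have hUpos : ∀ w ∈ Icc (0 : ℝ) 1, 0 < b ^ 2 - ρ * w ^ 2 := by
    intro w hw
    have hw2 : w ^ 2 ≤ 1 := by nlinarith [hw.1, hw.2]
    have : ρ * w ^ 2 ≤ ρ := by nlinarith
    rw [hρ] at this ⊢
    nlinarith
  have h2pos : ∀ w ∈ Icc (0 : ℝ) 1, 0 < 2 - w ^ 2 := by
    intro w hw; nlinarith [hw.1, hw.2]
  -- continuity of the substitution and of the de-singularised integrand on `[0, 1]`
  have hcont : ContinuousOn f (Icc 0 1) := Continuous.continuousOn (by rw [hf]; fun_prop)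
  have hPcont : ContinuousOn P (Icc 0 1) := by
    rw [hP]
    refine ContinuousOn.inv₀ (by fun_prop) fun w hw => ?_
    exact (mul_pos (mul_pos (hUpos w hw) (Real.sqrt_pos.2 (hUpos w hw)))
      (Real.sqrt_pos.2 (h2pos w hw))).ne'
  -- derivative and its sign on `(0, 1)`
  have hderiv : ∀ w ∈ Ioo (0 : ℝ) 1, HasDerivAt f (f' w) w := by
    intro w hw
    have hU := hUpos w (Ioo_subset_Icc_self hw)
    have h1 : HasDerivAt (fun x => b ^ 2 - ρ * x ^ 2) (-(ρ * (2 * w))) w := by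
      have := ((hasDerivAt_pow 2 w).const_mul ρ).const_sub (b ^ 2)
      exact this.congr_deriv (by norm_num)
    refine (h1.sqrt hU.ne').congr_deriv ?_
    rw [hf']
    field_simp
  have hnonpos : ∀ w ∈ Ioo (0 : ℝ) 1, f' w ≤ 0 := by
    intro w hw
    rw [hf']
    exact div_nonpos_of_nonpos_of_nonneg (by nlinarith [hw.1]) (Real.sqrt_nonneg _)
  -- endpoint values
  have hf0 : f 0 = b := by
    rw [hf]; dsimp only; rw [show b ^ 2 - ρ * 0 ^ 2 = b ^ 2 by ring, Real.sqrt_sq hb.le]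
  have hf1 : f 1 = Real.sqrt ((a ^ 2 + b ^ 2) / 2) := by
    rw [hf]; dsimp only; rw [show b ^ 2 - ρ * 1 ^ 2 = (a ^ 2 + b ^ 2) / 2 by rw [hρ]; ring]
  -- the pulled-back integrand on `(0, 1)`
  have hpt : ∀ w ∈ Ioo (0 : ℝ) 1, f' w • g (f w) = -P w := by
    intro w hw
    have hU := hUpos w (Ioo_subset_Icc_self hw)
    have h2 := h2pos w (Ioo_subset_Icc_self hw)
    have hsqU : Real.sqrt (b ^ 2 - ρ * w ^ 2) ^ 2 = b ^ 2 - ρ * w ^ 2 := Real.sq_sqrt hU.le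
    have hsq2 : Real.sqrt (2 - w ^ 2) ^ 2 = 2 - w ^ 2 := Real.sq_sqrt h2.le
    have hf2 : f w ^ 2 = b ^ 2 - ρ * w ^ 2 := by rw [hf]; exact hsqU
    have hprod : (f w ^ 2 - a ^ 2) * (b ^ 2 - f w ^ 2) = (ρ * w * Real.sqrt (2 - w ^ 2)) ^ 2 := by
      rw [hf2, mul_pow, mul_pow, hsq2, hρ]; ring
    have hroot : Real.sqrt ((f w ^ 2 - a ^ 2) * (b ^ 2 - f w ^ 2)) = ρ * w * Real.sqrt (2 - w ^ 2) := by
      rw [hprod, Real.sqrt_sq (mul_pos (mul_pos hρ0 hw.1) (Real.sqrt_pos.2 h2)).le]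
    rw [smul_eq_mul, hg, hP]
    dsimp only
    rw [hroot, hf2, hf']
    dsimp only
    have hsqUpos : 0 < Real.sqrt (b ^ 2 - ρ * w ^ 2) := Real.sqrt_pos.2 hU
    have hsq2pos : 0 < Real.sqrt (2 - w ^ 2) := Real.sqrt_pos.2 h2
    have hw0 : w ≠ 0 := hw.1.ne'
    field_simp
  -- change of variables (antitone version; no integrability hypothesis)
  have hcv := integral_Icc_deriv_smul_of_deriv_nonpos (g := g) hcont hderiv hnonpos zero_le_one
  rw [hf0, hf1] at hcv
  -- integrability transport
  have hPint : IntegrableOn P (Icc 0 1) := hPcont.integrableOn_Icc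
  have hpull : IntegrableOn (fun w => f' w • g (f w)) (Icc 0 1) := by
    rw [integrableOn_Icc_iff_integrableOn_Ioo]
    exact (hPint.neg.mono_set Ioo_subset_Icc_self).congr_fun (fun w hw => (hpt w hw).symm)
      measurableSet_Ioo
  have hgint : IntegrableOn g (Icc (Real.sqrt ((a ^ 2 + b ^ 2) / 2)) b) := by
    have := (integrableOn_Icc_deriv_smul_iff_of_deriv_nonpos (g := g) hcont hderiv hnonpos
      zero_le_one).1 hpull
    rwa [hf0, hf1] at this
  refine ⟨?_, hgint⟩
  have hR0b : Real.sqrt ((a ^ 2 + b ^ 2) / 2) ≤ b := by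
    rw [Real.sqrt_le_left hb.le]; nlinarith
  -- both sides as `Icc` integrals
  have lhs : (∫ w in (0 : ℝ)..1, P w) = ∫ w in Icc 0 1, P w := by
    rw [intervalIntegral.integral_of_le zero_le_one, integral_Icc_eq_integral_Ioc]
  have rhs : (∫ R in Real.sqrt ((a ^ 2 + b ^ 2) / 2)..b, g R)
      = ∫ R in Icc (Real.sqrt ((a ^ 2 + b ^ 2) / 2)) b, g R := by
    rw [intervalIntegral.integral_of_le hR0b, integral_Icc_eq_integral_Ioc]
  have hIcc : ∫ w in Icc 0 1, f' w • g (f w) = -∫ w in Icc 0 1, P w := by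
    rw [← MeasureTheory.integral_neg, integral_Icc_eq_integral_Ioo, integral_Icc_eq_integral_Ioo]
    exact setIntegral_congr_fun measurableSet_Ioo hpt
  rw [lhs, rhs]
  have := hcv
  rw [hIcc] at this
  exact neg_inj.1 this

/-- **Inner half of the midplane flux integral, de-singularised.** For `0 < a < b`, with
`ρ = (b² − a²)/2` and `R₀ = ((a² + b²)/2)^{1/2}`, the substitution `R = (a² + ρw²)^{1/2}`, `w ∈ [0, 1]`
(monotone, `R(0) = a`, `R(1) = R₀`) gives
`∫₀¹ dw / ((a² + ρw²)^{3/2} (2 − w²)^{1/2}) = ∫_{a}^{R₀} dR / (R² ((R² − a²)(b² − R²))^{1/2})`,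
and the singular right-hand integrand is integrable on `[a, R₀]`. [folklore; the inverse of the `§0`
reduction of `SolovevPCFIterQedge`] -/
theorem integral_innerBranch {a b : ℝ} (ha : 0 < a) (hab : a < b) :
    (∫ w in (0 : ℝ)..1, ((a ^ 2 + (b ^ 2 - a ^ 2) / 2 * w ^ 2)
        * Real.sqrt (a ^ 2 + (b ^ 2 - a ^ 2) / 2 * w ^ 2) * Real.sqrt (2 - w ^ 2))⁻¹)
      = ∫ R in a..Real.sqrt ((a ^ 2 + b ^ 2) / 2),
          1 / (R ^ 2 * Real.sqrt ((R ^ 2 - a ^ 2) * (b ^ 2 - R ^ 2))) ∧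
    IntegrableOn (fun R => 1 / (R ^ 2 * Real.sqrt ((R ^ 2 - a ^ 2) * (b ^ 2 - R ^ 2))))
      (Icc a (Real.sqrt ((a ^ 2 + b ^ 2) / 2))) := by
  have hb : 0 < b := ha.trans hab
  have hab2 : a ^ 2 < b ^ 2 := by nlinarith
  set ρ : ℝ := (b ^ 2 - a ^ 2) / 2 with hρ
  have hρ0 : 0 < ρ := by rw [hρ]; linarith
  set g : ℝ → ℝ := fun R => 1 / (R ^ 2 * Real.sqrt ((R ^ 2 - a ^ 2) * (b ^ 2 - R ^ 2))) with hg
  set Q : ℝ → ℝ := fun w => ((a ^ 2 + ρ * w ^ 2) * Real.sqrt (a ^ 2 + ρ * w ^ 2)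
      * Real.sqrt (2 - w ^ 2))⁻¹ with hQ
  set f : ℝ → ℝ := fun w => Real.sqrt (a ^ 2 + ρ * w ^ 2) with hf
  set f' : ℝ → ℝ := fun w => ρ * w / Real.sqrt (a ^ 2 + ρ * w ^ 2) with hf'
  have hUpos : ∀ w : ℝ, 0 < a ^ 2 + ρ * w ^ 2 := fun w => by positivity
  have h2pos : ∀ w ∈ Icc (0 : ℝ) 1, 0 < 2 - w ^ 2 := by
    intro w hw; nlinarith [hw.1, hw.2]
  have hcont : ContinuousOn f (Icc 0 1) := Continuous.continuousOn (by rw [hf]; fun_prop)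
  have hQcont : ContinuousOn Q (Icc 0 1) := by
    rw [hQ]
    refine ContinuousOn.inv₀ (by fun_prop) fun w hw => ?_
    exact (mul_pos (mul_pos (hUpos w) (Real.sqrt_pos.2 (hUpos w)))
      (Real.sqrt_pos.2 (h2pos w hw))).ne'
  have hderiv : ∀ w ∈ Ioo (0 : ℝ) 1, HasDerivAt f (f' w) w := by
    intro w _
    have h1 : HasDerivAt (fun x => a ^ 2 + ρ * x ^ 2) (ρ * (2 * w)) w := by
      have := ((hasDerivAt_pow 2 w).const_mul ρ).const_add (a ^ 2)
      exact this.congr_deriv (by norm_num)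
    refine (h1.sqrt (hUpos w).ne').congr_deriv ?_
    rw [hf']
    field_simp
  have hnonneg : ∀ w ∈ Ioo (0 : ℝ) 1, 0 ≤ f' w := by
    intro w hw
    rw [hf']
    exact div_nonneg (by nlinarith [hw.1]) (Real.sqrt_nonneg _)
  have hf0 : f 0 = a := by
    rw [hf]; dsimp only; rw [show a ^ 2 + ρ * 0 ^ 2 = a ^ 2 by ring, Real.sqrt_sq ha.le]
  have hf1 : f 1 = Real.sqrt ((a ^ 2 + b ^ 2) / 2) := by
    rw [hf]; dsimp only; rw [show a ^ 2 + ρ * 1 ^ 2 = (a ^ 2 + b ^ 2) / 2 by rw [hρ]; ring]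
  have hpt : ∀ w ∈ Ioo (0 : ℝ) 1, f' w • g (f w) = Q w := by
    intro w hw
    have hU := hUpos w
    have h2 := h2pos w (Ioo_subset_Icc_self hw)
    have hsqU : Real.sqrt (a ^ 2 + ρ * w ^ 2) ^ 2 = a ^ 2 + ρ * w ^ 2 := Real.sq_sqrt hU.le
    have hsq2 : Real.sqrt (2 - w ^ 2) ^ 2 = 2 - w ^ 2 := Real.sq_sqrt h2.le
    have hf2 : f w ^ 2 = a ^ 2 + ρ * w ^ 2 := by rw [hf]; exact hsqU
    have hprod : (f w ^ 2 - a ^ 2) * (b ^ 2 - f w ^ 2) = (ρ * w * Real.sqrt (2 - w ^ 2)) ^ 2 := by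
      rw [hf2, mul_pow, mul_pow, hsq2, hρ]; ring
    have hroot : Real.sqrt ((f w ^ 2 - a ^ 2) * (b ^ 2 - f w ^ 2)) = ρ * w * Real.sqrt (2 - w ^ 2) := by
      rw [hprod, Real.sqrt_sq (mul_pos (mul_pos hρ0 hw.1) (Real.sqrt_pos.2 h2)).le]
    rw [smul_eq_mul, hg, hQ]
    dsimp only
    rw [hroot, hf2, hf']
    dsimp only
    have hsqUpos : 0 < Real.sqrt (a ^ 2 + ρ * w ^ 2) := Real.sqrt_pos.2 hU
    have hsq2pos : 0 < Real.sqrt (2 - w ^ 2) := Real.sqrt_pos.2 h2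
    have hw0 : w ≠ 0 := hw.1.ne'
    field_simp
  have hcv := integral_Icc_deriv_smul_of_deriv_nonneg (g := g) hcont hderiv hnonneg zero_le_one
  rw [hf0, hf1] at hcv
  have hQint : IntegrableOn Q (Icc 0 1) := hQcont.integrableOn_Icc
  have hpull : IntegrableOn (fun w => f' w • g (f w)) (Icc 0 1) := by
    rw [integrableOn_Icc_iff_integrableOn_Ioo]
    exact (hQint.mono_set Ioo_subset_Icc_self).congr_fun (fun w hw => (hpt w hw).symm)
      measurableSet_Ioo
  have hgint : IntegrableOn g (Icc a (Real.sqrt ((a ^ 2 + b ^ 2) / 2))) := by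
    have := (integrableOn_Icc_deriv_smul_iff_of_deriv_nonneg (g := g) hcont hderiv hnonneg
      zero_le_one).1 hpull
    rwa [hf0, hf1] at this
  refine ⟨?_, hgint⟩
  have haR0 : a ≤ Real.sqrt ((a ^ 2 + b ^ 2) / 2) :=
    calc a = Real.sqrt (a ^ 2) := (Real.sqrt_sq ha.le).symm
      _ ≤ Real.sqrt ((a ^ 2 + b ^ 2) / 2) := Real.sqrt_le_sqrt (by nlinarith)
  have lhs : (∫ w in (0 : ℝ)..1, Q w) = ∫ w in Icc 0 1, Q w := by
    rw [intervalIntegral.integral_of_le zero_le_one, integral_Icc_eq_integral_Ioc]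
  have rhs : (∫ R in a..Real.sqrt ((a ^ 2 + b ^ 2) / 2), g R)
      = ∫ R in Icc a (Real.sqrt ((a ^ 2 + b ^ 2) / 2)), g R := by
    rw [intervalIntegral.integral_of_le haR0, integral_Icc_eq_integral_Ioc]
  have hIcc : ∫ w in Icc 0 1, f' w • g (f w) = ∫ w in Icc 0 1, Q w := by
    rw [integral_Icc_eq_integral_Ioo, integral_Icc_eq_integral_Ioo]
    exact setIntegral_congr_fun measurableSet_Ioo hpt
  rw [lhs, rhs, ← hIcc]
  exact hcv

/-- **The de-singularised edge integral equals the midplane flux integral of Lee–Cerfon (q4):** for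
`0 < a < b`, `ρ = (b² − a²)/2`,
`∫₀¹ [((b² − ρw²)^{3/2}(2 − w²)^{1/2})⁻¹ + ((a² + ρw²)^{3/2}(2 − w²)^{1/2})⁻¹] dw
   = ∫_a^b dR/(R²((R² − a²)(b² − R²))^{1/2}) = E((1 − a²/b²)^{1/2})/(a² b)`.
[cite: LeeCerfon2015, §4.1 eq. (q4)] (last equality:
`Literature.MathematicalPhysics.MHD.Solovev.integral_qLC_kernel`). -/
theorem integral_desingularised_eq {a b : ℝ} (ha : 0 < a) (hab : a < b) :
    (∫ w in (0 : ℝ)..1,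
        (((b ^ 2 - (b ^ 2 - a ^ 2) / 2 * w ^ 2) * Real.sqrt (b ^ 2 - (b ^ 2 - a ^ 2) / 2 * w ^ 2)
            * Real.sqrt (2 - w ^ 2))⁻¹
          + ((a ^ 2 + (b ^ 2 - a ^ 2) / 2 * w ^ 2) * Real.sqrt (a ^ 2 + (b ^ 2 - a ^ 2) / 2 * w ^ 2)
            * Real.sqrt (2 - w ^ 2))⁻¹))
      = ∫ R in a..b, 1 / (R ^ 2 * Real.sqrt ((R ^ 2 - a ^ 2) * (b ^ 2 - R ^ 2))) ∧
    (∫ R in a..b, 1 / (R ^ 2 * Real.sqrt ((R ^ 2 - a ^ 2) * (b ^ 2 - R ^ 2))))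
      = ellipticE (Real.sqrt (1 - a ^ 2 / b ^ 2)) / (a ^ 2 * b) := by
  obtain ⟨hout, hout_int⟩ := integral_outerBranch ha hab
  obtain ⟨hin, hin_int⟩ := integral_innerBranch ha hab
  have hb : 0 < b := ha.trans hab
  have haR0 : a ≤ Real.sqrt ((a ^ 2 + b ^ 2) / 2) :=
    calc a = Real.sqrt (a ^ 2) := (Real.sqrt_sq ha.le).symm
      _ ≤ Real.sqrt ((a ^ 2 + b ^ 2) / 2) := Real.sqrt_le_sqrt (by nlinarith)
  have hR0b : Real.sqrt ((a ^ 2 + b ^ 2) / 2) ≤ b := by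
    rw [Real.sqrt_le_left hb.le]; nlinarith
  refine ⟨?_, integral_qLC_kernel ha hab⟩
  -- integrability of the two continuous de-singularised integrands on `[0, 1]`
  have hPc : ContinuousOn (fun w : ℝ => ((b ^ 2 - (b ^ 2 - a ^ 2) / 2 * w ^ 2)
      * Real.sqrt (b ^ 2 - (b ^ 2 - a ^ 2) / 2 * w ^ 2) * Real.sqrt (2 - w ^ 2))⁻¹) (uIcc 0 1) := by
    rw [uIcc_of_le zero_le_one]
    refine ContinuousOn.inv₀ (by fun_prop) fun w hw => ?_
    have hw2 : w ^ 2 ≤ 1 := by nlinarith [hw.1, hw.2]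
    have hU : 0 < b ^ 2 - (b ^ 2 - a ^ 2) / 2 * w ^ 2 := by nlinarith
    have h2 : 0 < 2 - w ^ 2 := by nlinarith
    exact (mul_pos (mul_pos hU (Real.sqrt_pos.2 hU)) (Real.sqrt_pos.2 h2)).ne'
  have hQc : ContinuousOn (fun w : ℝ => ((a ^ 2 + (b ^ 2 - a ^ 2) / 2 * w ^ 2)
      * Real.sqrt (a ^ 2 + (b ^ 2 - a ^ 2) / 2 * w ^ 2) * Real.sqrt (2 - w ^ 2))⁻¹) (uIcc 0 1) := by
    rw [uIcc_of_le zero_le_one]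
    refine ContinuousOn.inv₀ (by fun_prop) fun w hw => ?_
    have hU : 0 < a ^ 2 + (b ^ 2 - a ^ 2) / 2 * w ^ 2 :=
      add_pos_of_pos_of_nonneg (pow_pos ha 2) (mul_nonneg (by nlinarith) (sq_nonneg w))
    have h2 : 0 < 2 - w ^ 2 := by nlinarith [hw.1, hw.2]
    exact (mul_pos (mul_pos hU (Real.sqrt_pos.2 hU)) (Real.sqrt_pos.2 h2)).ne'
  rw [intervalIntegral.integral_add hPc.intervalIntegrable hQc.intervalIntegrable, hout, hin,
    add_comm]
  exact intervalIntegral.integral_add_adjacent_intervals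
    ((intervalIntegrable_iff_integrableOn_Icc_of_le haR0).2 hin_int)
    ((intervalIntegrable_iff_integrableOn_Icc_of_le hR0b).2 hout_int)

/-! ## §2 The instance of record: ITER-like PCF Solov'ev, edge surface `Ψ = 0`, `a = 17/25`, `b = 33/25` -/

/-- `Poly.eval [2] w = 2`. [folklore] -/
private theorem eval_two (w : ℝ) : Poly.eval [2] w = 2 := by
  simp only [Poly.eval_cons, Poly.eval_nil]; push_cast; ring

/-- `U₊(w) = b² − ρw²` with `b = 33/25`, `ρ = 16/25`. [folklore] -/
theorem Uplus_eq (w : ℝ) :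
    Uplus w = (33 / 25 : ℝ) ^ 2 - ((33 / 25 : ℝ) ^ 2 - (17 / 25) ^ 2) / 2 * w ^ 2 := by
  unfold Uplus; push_cast; ring

/-- `U₋(w) = a² + ρw²` with `a = 17/25`, `ρ = 16/25`. [folklore] -/
theorem Uminus_eq (w : ℝ) :
    Uminus w = (17 / 25 : ℝ) ^ 2 + ((33 / 25 : ℝ) ^ 2 - (17 / 25) ^ 2) / 2 * w ^ 2 := by
  unfold Uminus; push_cast; ring

/-- **`edgeI` is twice the singular midplane flux integral of Lee–Cerfon (q4) (line 2) for the edge surface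
of the ITER-like PCF instance** (`R_min = 17/25`, `R_max = 33/25`). [cite: LeeCerfon2015, §4.1 eq. (q4)] -/
theorem edgeI_eq_two_mul_integral :
    edgeI = 2 * ∫ R in (17 / 25 : ℝ)..(33 / 25),
      1 / (R ^ 2 * Real.sqrt ((R ^ 2 - (17 / 25) ^ 2) * ((33 / 25) ^ 2 - R ^ 2))) := by
  have ha : (0 : ℝ) < 17 / 25 := by norm_num
  have hab : (17 / 25 : ℝ) < 33 / 25 := by norm_num
  obtain ⟨h1, -⟩ := integral_desingularised_eq ha hab
  rw [← h1, ← intervalIntegral.integral_const_mul]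
  unfold edgeI
  refine intervalIntegral.integral_congr fun w _ => ?_
  rw [toFun_edgeIntegrand, eval_two, Uplus_eq, Uminus_eq]
  ring

/-- **`edgeI = 2·E(k)/(a²b)`**, `k = √(800/1089)`, `a = 17/25`, `b = 33/25`. [cite: LeeCerfon2015, §4.1 eq. (q4)] -/
theorem edgeI_eq_ellipticE :
    edgeI = 2 * (ellipticE (Real.sqrt (800 / 1089)) / ((17 / 25 : ℝ) ^ 2 * (33 / 25))) := by
  have ha : (0 : ℝ) < 17 / 25 := by norm_num
  have hab : (17 / 25 : ℝ) < 33 / 25 := by norm_num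
  rw [edgeI_eq_two_mul_integral, (integral_desingularised_eq ha hab).2,
    show (1 : ℝ) - (17 / 25) ^ 2 / (33 / 25) ^ 2 = 800 / 1089 by norm_num]

/-- **Kernel-checked enclosure of a complete elliptic integral of the second kind** (by-product): the Bench's
certified enclosure of `edgeI` encloses `E(√(800/1089)) = edgeI·(a²b)/2`. [folklore] -/
theorem ellipticE_bounds :
    ((2417703717632288670339691/604462909807314587353088 : ℚ) : ℝ) * ((17 / 25 : ℝ) ^ 2 * (33 / 25) / 2)
        ≤ ellipticE (Real.sqrt (800 / 1089)) ∧
      ellipticE (Real.sqrt (800 / 1089))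
        ≤ ((2417703717632288685282095/604462909807314587353088 : ℚ) : ℝ) * ((17 / 25 : ℝ) ^ 2 * (33 / 25) / 2) := by
  obtain ⟨hlo, hhi⟩ := edgeI_bounds
  have hE : ellipticE (Real.sqrt (800 / 1089)) = edgeI * ((17 / 25 : ℝ) ^ 2 * (33 / 25) / 2) := by
    rw [edgeI_eq_ellipticE]; field_simp
  rw [hE]
  constructor
  · exact mul_le_mul_of_nonneg_right hlo (by norm_num)
  · exact mul_le_mul_of_nonneg_right hhi (by norm_num)

/-- **The certified edge safety factor per unit `F` equals `E(k)/(2π√K·a²b)`** (`K = Kconst`, `k² = 800/1089`,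
`a = 17/25`, `b = 33/25`) — exact kernel identity. [cite: LeeCerfon2015, §4.1 eq. (q4)] -/
theorem qEdgeOverF_eq_ellipticE :
    qEdgeOverF = ellipticE (Real.sqrt (800 / 1089))
      / (2 * π * Real.sqrt (Kconst : ℝ) * ((17 / 25 : ℝ) ^ 2 * (33 / 25))) := by
  have hK : 0 < Real.sqrt (Kconst : ℝ) := Real.sqrt_pos.2 (by simp only [Kconst]; push_cast; norm_num)
  unfold qEdgeOverF
  rw [edgeI_eq_ellipticE]
  field_simp
  ring

/-- The exact rational identity linking model-5's on-axis datum `r = (q₀/F)²`, sos-6's prefactor constant `K`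
and the axis radius² `u₀ = R_a² = 689/625`: `16·r·K·u₀³ = 1`. [folklore] -/
theorem sixteen_mul_q0OverFSq_mul_Kconst :
    (16 : ℝ) * (q0OverFSq : ℝ) * (Kconst : ℝ) * (689 / 625) ^ 3 = 1 := by
  simp only [q0OverFSq, Kconst]; push_cast; norm_num

/-- **The certified number IS the printed closed form (q4) on the instance of record:**
`qEdgeOverF = qLC (q₀/F) R_a R_min R_max` with `q₀/F = √r` (model-5's exact on-axis value), `R_a = √(689/625)`,
`R_min = 17/25`, `R_max = 33/25` — i.e. `q_edge/F = (2(q₀/F)/π)(R_a³/(R_min² R_max)) E(k)`.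
[cite: LeeCerfon2015, §4.1 eq. (q4)] -/
theorem qEdgeOverF_eq_qLC :
    qEdgeOverF = qLC (Real.sqrt (q0OverFSq : ℝ)) (Real.sqrt (689 / 625)) (17 / 25) (33 / 25) := by
  have hr0 : 0 < (q0OverFSq : ℝ) := by simp only [q0OverFSq]; push_cast; norm_num
  have hK0 : 0 < (Kconst : ℝ) := by simp only [Kconst]; push_cast; norm_num
  have hr : 0 < Real.sqrt (q0OverFSq : ℝ) := Real.sqrt_pos.2 hr0
  have hK : 0 < Real.sqrt (Kconst : ℝ) := Real.sqrt_pos.2 hK0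
  have hu : 0 < Real.sqrt (689 / 625 : ℝ) := Real.sqrt_pos.2 (by norm_num)
  -- the scalar identity `4 √r √K (√u₀)³ = 1`
  set x : ℝ := 4 * Real.sqrt (q0OverFSq : ℝ) * Real.sqrt (Kconst : ℝ) * Real.sqrt (689 / 625) ^ 3 with hx
  have hxpos : 0 < x := by positivity
  have hx2 : x ^ 2 = 1 := by
    have h3 : (Real.sqrt (689 / 625 : ℝ) ^ 3) ^ 2 = (689 / 625 : ℝ) ^ 3 := by
      rw [← pow_mul, show 3 * 2 = 2 * 3 from rfl, pow_mul, Real.sq_sqrt (by norm_num)]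
    calc x ^ 2 = 16 * Real.sqrt (q0OverFSq : ℝ) ^ 2 * Real.sqrt (Kconst : ℝ) ^ 2
          * (Real.sqrt (689 / 625 : ℝ) ^ 3) ^ 2 := by rw [hx]; ring
      _ = 16 * (q0OverFSq : ℝ) * (Kconst : ℝ) * (689 / 625) ^ 3 := by
          rw [Real.sq_sqrt hr0.le, Real.sq_sqrt hK0.le, h3]
      _ = 1 := sixteen_mul_q0OverFSq_mul_Kconst
  have hx1 : x = 1 := by nlinarith
  have hKinv : Real.sqrt (Kconst : ℝ)
      = 1 / (4 * Real.sqrt (q0OverFSq : ℝ) * Real.sqrt (689 / 625) ^ 3) := by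
    rw [eq_div_iff (by positivity)]
    rw [hx] at hx1
    linear_combination hx1
  rw [qEdgeOverF_eq_ellipticE, hKinv]
  unfold qLC
  rw [show (1 : ℝ) - (17 / 25) ^ 2 / (33 / 25) ^ 2 = 800 / 1089 by norm_num]
  field_simp
  ring

end Summit.Ventures.FusionMHD.Bench.SolovevPCFIter
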